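import Literature.NumberTheory.DiophantineGeometry.GenEllDeCriticalValuesFamily
import Literature.NumberTheory.DiophantineGeometry.GenEllDeFibresFamily
import Literature.NumberTheory.DiophantineGeometry.GenEllDeRamificationArchFamilyHeight
import HarnessLib

/-!
# `R_{t_c} ⊆ E_φ` and `x(R_{t_c}) ⊆ X_φ` for the FAMILY `t_c` on `D_e : r^e = x(1−x)`; the archimedean
# lower bound for `N_c` under separation from `X_φ` ([GenEll] Thm. 2.1 (ii) ⇒ (i) — the `c`-parametric
# twin of `GenEllDeCriticalValuesXphi`)

S. Mochizuki, *Arithmetic elliptic curves in general position*, Math. J. Okayama Univ. **52** (2010)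
[cite: MochizukiGenEll2010, Thm 2.1 p.12], proof of Thm. 2.1 (ii) ⇒ (i), kurims pp. 12–13.  PROOF-ONLY
bridge (abc-iut cell, route item `Summit.ABC.ABC.Theses.IUTThetaPilot.GenEllTwo`, number-field-only
plan GENELLTWO-P1ROUTE, OWNER RULING #6 and its amendment: the per-configuration protection uses the
FAMILY `t_c = 1/r + c·r^{k+1}/s`, `c ∈ ℚ^×`) between

* `GenEllDeCriticalValuesFamily.lean` (`DeCrit.NvalC k c` = the ramification form `N_c`,
  `DeCrit.tC` = `t_c`, `DeCrit.critSetC k c ⊇` the critical values of `t_c`),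
* `GenEllDeFibresFamily.lean` (`De.EphiC k c B = t_c⁻¹(B)`, `De.XphiC k c B = x(E_φ)` as `Finset`s),
* `GenEllDeRamificationArchFamily(Height).lean` (the archimedean lower bound for
  `DeFamily.N k c = N_c` under separation from its zeros, and its `x`-currency / number-field forms).

For `c ∈ ℚ^×` and every finite `B ⊆ ℂ` CONTAINING `critSetC k c` (e.g. the cusp-fibre
`ρ_T⁻¹{0,1,∞}` of the Belyi map built on the critical values): every zero of `N_c` on `D_e(ℂ)` lies in
`E_φ = t_c⁻¹(B)` (`mem_EphiC_of_N_eq_zero_of_subset`), its `x`-coordinate lies in `X_φ`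
(`fst_mem_XphiC_of_N_eq_zero`, `critXC_mem_XphiC`) — the printed "`R_t ⊆ E_φ`" for the family —, hence
separation of a point's `x`-coordinate from `X_φ` (the spines' hypothesis "all conjugates of `P.x`
`r`-far from `X_φ` at `∞`") implies sup-distance separation from the zeros of `N_c` and therefore the
archimedean lower bound and its number-field forms (`exists_pos_le_norm_N_of_XphiC_separated`,
`sum_posLog_le_of_XphiC_separated`, `exists_sum_posLog_le_of_XphiC_separated`,
`le_norm_embedding_N_of_XphiC_separated`, `posLog_infinitePlace_le_of_XphiC_separated` — the last
two are the per-place `harch` inputs of the W5d slope assembly at `a := N_c(x, r)`).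
Bridge `DeFamily.N_eq_NvalC`: the two spellings of `N_c` in the tree (`DeFamily.N` of
`GenEllDeCriticalCollisions`, `DeCrit.NvalC` of `GenEllDeCriticalLocusFamily`) agree definitionally.
Everything proved; no definitions; classical and undisputed; nothing here refers to the disputed parts
of the abc-iut corpus.
-/

noncomputable section

open Polynomial Real

namespace Literature.NumberTheory.DiophantineGeometry.GenEll

namespace DeFamily

variable {k : ℕ}

/-! ### The two spellings of `N_c` agree -/

/-- `DeFamily.N k c` (`GenEllDeCriticalCollisions`) and `DeCrit.NvalC k c` (`GenEllDeCriticalLocusFamily`)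
are the same function `N_c(x, r) = −(1−2x)³ + c·((k+1)r^{k+2} − 2r^{3k+3})`, definitionally.
[cite: MochizukiGenEll2010, Thm 2.1 p.12] -/
theorem N_eq_NvalC {F : Type*} [Field F] (c : F) (P : F × F) : N k c P = DeCrit.NvalC k c P := rfl

/-- The zero sets agree: `{Q ∈ D_e | N_c(Q) = 0} = {Q | Q on the curve ∧ NvalC_c(Q) = 0}`.
[cite: MochizukiGenEll2010, Thm 2.1 p.12] -/
theorem zeroSet_eq_zeroSetC {F : Type*} [Field F] (c : F) :
    {Q : F × F | Q ∈ DeArch.curve F k ∧ N k c Q = 0} =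
      {z : F × F | z.2 ^ (2 * k + 1) = z.1 * (1 - z.1) ∧ DeCrit.NvalC k c z = 0} := rfl

/-! ### Zeros of `N_c` lie in `E_φ` once `B` contains their `t_c`-values -/

/-- A zero `P` of `N_c` (`c ≠ 0`) on `D_e(F)` whose `t_c`-value lies in `B` is a point of
`E_φ = t_c⁻¹(B)` (it is not a pole of `t_c`). [cite: MochizukiGenEll2010, Thm 2.1 p.12] -/
theorem mem_EphiC_of_N_eq_zero {F : Type*} [Field F] [CharZero F] {c : F} (hc : c ≠ 0)
    {B : Finset F} {P : F × F} (hP : P ∈ DeArch.curve F k) (hN : N k c P = 0)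
    (hB : DeCrit.tC k c P.1 P.2 ∈ B) : P ∈ De.EphiC k c B := by
  obtain ⟨hr, hs⟩ := DeCrit.snd_ne_zero_and_one_sub_two_mul_ne_zero_of_NvalC (k := k) hc
    (DeArch.mem_curve_iff.mp hP) hN
  exact (De.mem_EphiC_iff_t hc).mpr ⟨DeArch.mem_curve_iff.mp hP, hr, hs, hB⟩

/-- **`R_{t_c} ⊆ E_φ`** (over `ℂ`, `c ∈ ℚ^×`): if `B ⊇ critSetC k c` then every zero of `N_c` on
`D_e(ℂ)` lies in `E_φ = t_c⁻¹(B)`. [cite: MochizukiGenEll2010, Thm 2.1 p.12] -/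
theorem mem_EphiC_of_N_eq_zero_of_subset {c : ℚ} (hc : c ≠ 0) {B : Finset ℂ}
    (hB : DeCrit.critSetC k c ⊆ B) {P : ℂ × ℂ} (hP : P ∈ DeArch.curve ℂ k)
    (hN : N k (c : ℂ) P = 0) : P ∈ De.EphiC k (c : ℂ) B :=
  mem_EphiC_of_N_eq_zero (Rat.cast_ne_zero.mpr hc) hP hN
    (hB (DeCrit.tC_mem_critSetC_of_NvalC_eq_zero hc (DeArch.mem_curve_iff.mp hP) hN))

/-- **`x(R_{t_c}) ⊆ X_φ`**: if `B ⊇ critSetC k c` then the `x`-coordinate of every zero of `N_c` on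
`D_e(ℂ)` lies in `X_φ = x(t_c⁻¹ B)`. [cite: MochizukiGenEll2010, Thm 2.1 p.12] -/
theorem fst_mem_XphiC_of_N_eq_zero {c : ℚ} (hc : c ≠ 0) {B : Finset ℂ}
    (hB : DeCrit.critSetC k c ⊆ B) {P : ℂ × ℂ} (hP : P ∈ DeArch.curve ℂ k)
    (hN : N k (c : ℂ) P = 0) : P.1 ∈ De.XphiC k (c : ℂ) B :=
  De.mem_XphiC.mpr ⟨P.2, mem_EphiC_of_N_eq_zero_of_subset hc hB hP hN⟩

/-- Set form of `x(R_{t_c}) ⊆ X_φ`: the hypothesis `hX` of the `x`-currency lemmas of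
`GenEllDeRamificationArchFamily(Height)` holds with `X := X_φ`.
[cite: MochizukiGenEll2010, Thm 2.1 p.12] -/
theorem forall_zero_fst_mem_XphiC {c : ℚ} (hc : c ≠ 0) {B : Finset ℂ}
    (hB : DeCrit.critSetC k c ⊆ B) :
    ∀ Q ∈ DeArch.curve ℂ k, N k (c : ℂ) Q = 0 → Q.1 ∈ (↑(De.XphiC k (c : ℂ) B) : Set ℂ) :=
  fun _ hQ hN => Finset.mem_coe.mpr (fst_mem_XphiC_of_N_eq_zero hc hB hQ hN)

/-- The critical abscissae lie in `X_φ`: `critXC θ ∈ X_φ` for every complex root `θ` of `R_c`,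
whenever `B ⊇ critSetC k c`. [cite: MochizukiGenEll2010, Thm 2.1 p.12] -/
theorem critXC_mem_XphiC {c : ℚ} (hc : c ≠ 0) {B : Finset ℂ} (hB : DeCrit.critSetC k c ⊆ B)
    {θ : ℂ} (hθ : (DeCrit.RpolyC k (c : ℂ)).eval θ = 0) :
    DeCrit.critXC k (c : ℂ) θ ∈ De.XphiC k (c : ℂ) B := by
  have hc' : (c : ℂ) ≠ 0 := Rat.cast_ne_zero.mpr hc
  have hmem : (DeCrit.critPointC k (c : ℂ) θ : ℂ × ℂ) ∈ DeArch.curve ℂ k :=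
    DeArch.mem_curve_iff.mpr
      (DeCrit.critPointC_mem k two_ne_zero (DeArch.cast_two_mul_add_one_ne_zero k) hc' hθ)
  have hN : N k (c : ℂ) (DeCrit.critPointC k (c : ℂ) θ) = 0 :=
    DeCrit.NvalC_critPointC k two_ne_zero (DeArch.cast_two_mul_add_one_ne_zero k) hc' hθ
  exact fst_mem_XphiC_of_N_eq_zero hc hB hmem hN

/-! ### Consequence: separation from `X_φ` gives the archimedean lower bound for `N_c` -/

/-- A point whose `x`-coordinate is `ρ`-far from `X_φ` (`B ⊇ critSetC k c`) is `ρ`-far (sup-distance on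
`ℂ × ℂ`) from every zero of `N_c` on `D_e(ℂ)`. [cite: MochizukiGenEll2010, Thm 2.1 p.12] -/
theorem separated_of_XphiC_separated {c : ℚ} (hc : c ≠ 0) {B : Finset ℂ}
    (hB : DeCrit.critSetC k c ⊆ B) {ρ : ℝ} {P : ℂ × ℂ}
    (hsep : ∀ a ∈ De.XphiC k (c : ℂ) B, ρ ≤ ‖P.1 - a‖) :
    ∀ Q ∈ DeArch.curve ℂ k, N k (c : ℂ) Q = 0 → ρ ≤ dist P Q :=
  separated_of_fst_separated (forall_zero_fst_mem_XphiC hc hB)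
    fun a ha => hsep a (Finset.mem_coe.mp ha)

/-- LOWER BOUND UNDER SEPARATION FROM `X_φ`: for every `c ∈ ℚ^×` and `ρ > 0` there is `δ > 0` (depending
only on `e`, `c`, `ρ`: the constant of `DeFamily.exists_pos_le_norm_N_of_separated`) such that for every
finite `B ⊇ critSetC k c` and every `P ∈ D_e(ℂ)` whose `x`-coordinate is `ρ`-far from
`X_φ = x(t_c⁻¹B)`, `‖N_c(P)‖ ≥ δ`. [cite: MochizukiGenEll2010, Thm 2.1 p.12] -/
theorem exists_pos_le_norm_N_of_XphiC_separated (k : ℕ) {c : ℚ} (hc : c ≠ 0) {ρ : ℝ}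
    (hρ : 0 < ρ) :
    ∃ δ : ℝ, 0 < δ ∧ ∀ B : Finset ℂ, DeCrit.critSetC k c ⊆ B → ∀ P ∈ DeArch.curve ℂ k,
      (∀ a ∈ De.XphiC k (c : ℂ) B, ρ ≤ ‖P.1 - a‖) → δ ≤ ‖N k (c : ℂ) P‖ := by
  obtain ⟨δ, hδ, h⟩ := exists_pos_le_norm_N_of_separated k (c := (c : ℂ)) (Rat.cast_ne_zero.mpr hc) hρ
  exact ⟨δ, hδ, fun B hB P hP hsep => h P hP (separated_of_XphiC_separated hc hB hsep)⟩

/-- Per-embedding form: `δ ≤ ‖σ(N_c(x, r))‖` for each `σ : K →+* ℂ` whose conjugate `σ x` is `ρ`-far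
from `X_φ` (`B ⊇ critSetC k c`) — the archimedean separation hypothesis `δ ≤ ‖σ a‖` of the place-wise
summation at `a := N_c(x, r)`. [cite: MochizukiGenEll2010, Thm 2.1 p.12] -/
theorem le_norm_embedding_N_of_XphiC_separated {K : Type*} [Field K] {x r : K} {c : ℚ}
    (hc : c ≠ 0) (hxr : r ^ (2 * k + 1) = x * (1 - x)) (σ : K →+* ℂ) {ρ δ : ℝ}
    (h : ∀ P ∈ DeArch.curve ℂ k, (∀ Q ∈ DeArch.curve ℂ k, N k (c : ℂ) Q = 0 → ρ ≤ dist P Q) →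
      δ ≤ ‖N k (c : ℂ) P‖)
    {B : Finset ℂ} (hB : DeCrit.critSetC k c ⊆ B)
    (hsep : ∀ a ∈ De.XphiC k (c : ℂ) B, ρ ≤ ‖σ x - a‖) :
    δ ≤ ‖σ (N k (c : K) (x, r))‖ :=
  le_norm_embedding_N_ratCast hxr σ h (separated_of_XphiC_separated hc hB (P := (σ x, σ r)) hsep)

/-- NUMBER-FIELD FORM UNDER SEPARATION OF THE CONJUGATES FROM `X_φ` — the shape "all conjugates of `P.x`
`r`-far from `X_φ` at `∞`" of the spines: with the constant `δ` of
`DeFamily.exists_pos_le_norm_N_of_separated` and any finite `B ⊇ critSetC k c`,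
`Σ_{σ : K →+* ℂ} log⁺ ‖σ(N_c(x,r))‖⁻¹ ≤ [K:ℚ]·log⁺ δ⁻¹`. [cite: MochizukiGenEll2010, Thm 2.1 p.12] -/
theorem sum_posLog_le_of_XphiC_separated {K : Type*} [Field K] [NumberField K] {x r : K} {c : ℚ}
    (hc : c ≠ 0) (hxr : r ^ (2 * k + 1) = x * (1 - x)) {ρ δ : ℝ} (hδ : 0 < δ)
    (h : ∀ P ∈ DeArch.curve ℂ k, (∀ Q ∈ DeArch.curve ℂ k, N k (c : ℂ) Q = 0 → ρ ≤ dist P Q) →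
      δ ≤ ‖N k (c : ℂ) P‖)
    {B : Finset ℂ} (hB : DeCrit.critSetC k c ⊆ B)
    (hsep : ∀ σ : K →+* ℂ, ∀ a ∈ De.XphiC k (c : ℂ) B, ρ ≤ ‖σ x - a‖) :
    ∑ σ : K →+* ℂ, log⁺ ‖σ (N k (c : K) (x, r))‖⁻¹ ≤ Module.finrank ℚ K * log⁺ δ⁻¹ :=
  sum_posLog_le hxr hδ h fun σ => separated_of_XphiC_separated hc hB (P := (σ x, σ r)) (hsep σ)

/-- NUMBER-FIELD FORM, packaged: for every `c ∈ ℚ^×` and `ρ > 0` there is `C ≥ 0` (depending only on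
`e`, `c`, `ρ`) such that for every finite `B ⊇ critSetC k c`, every number field `K` and every
`(x, r) ∈ D_e(K)` all of whose conjugates `σ x` are `ρ`-far from `X_φ = x(t_c⁻¹B)`,
`Σ_{σ : K →+* ℂ} log⁺ ‖σ(N_c(x,r))‖⁻¹ ≤ [K:ℚ]·C`. [cite: MochizukiGenEll2010, Thm 2.1 p.12] -/
theorem exists_sum_posLog_le_of_XphiC_separated (k : ℕ) {c : ℚ} (hc : c ≠ 0) {ρ : ℝ}
    (hρ : 0 < ρ) :
    ∃ C : ℝ, 0 ≤ C ∧ ∀ (B : Finset ℂ), DeCrit.critSetC k c ⊆ B →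
      ∀ (K : Type) [Field K] [NumberField K] (x r : K), r ^ (2 * k + 1) = x * (1 - x) →
      (∀ σ : K →+* ℂ, ∀ a ∈ De.XphiC k (c : ℂ) B, ρ ≤ ‖σ x - a‖) →
      ∑ σ : K →+* ℂ, log⁺ ‖σ (N k (c : K) (x, r))‖⁻¹ ≤ Module.finrank ℚ K * C := by
  obtain ⟨δ, hδ, h⟩ := exists_pos_le_norm_N_of_separated k (c := (c : ℂ)) (Rat.cast_ne_zero.mpr hc) hρ
  exact ⟨log⁺ δ⁻¹, posLog_nonneg, fun B hB K _ _ x r hxr hsep =>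
    sum_posLog_le_of_XphiC_separated hc hxr hδ h hB hsep⟩

/-- `InfinitePlace` form: `δ ≤ w (N_c(x, r))` for every infinite place `w` whose embedding `w.embedding x`
is `ρ`-far from `X_φ` (`B ⊇ critSetC k c`). [cite: MochizukiGenEll2010, Thm 2.1 p.12] -/
theorem le_infinitePlace_N_of_XphiC_separated {K : Type*} [Field K] {x r : K} {c : ℚ}
    (hc : c ≠ 0) (hxr : r ^ (2 * k + 1) = x * (1 - x)) {ρ δ : ℝ}
    (h : ∀ P ∈ DeArch.curve ℂ k, (∀ Q ∈ DeArch.curve ℂ k, N k (c : ℂ) Q = 0 → ρ ≤ dist P Q) →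
      δ ≤ ‖N k (c : ℂ) P‖)
    {B : Finset ℂ} (hB : DeCrit.critSetC k c ⊆ B) (w : NumberField.InfinitePlace K)
    (hsep : ∀ a ∈ De.XphiC k (c : ℂ) B, ρ ≤ ‖w.embedding x - a‖) :
    δ ≤ w (N k (c : K) (x, r)) :=
  le_infinitePlace_N hxr h w (separated_of_XphiC_separated hc hB
    (P := (w.embedding x, w.embedding r)) hsep)

/-- `InfinitePlace` log form: `log⁺ (w (N_c(x,r)))⁻¹ ≤ log⁺ δ⁻¹` under `ρ`-separation of `w.embedding x`
from `X_φ` — the hypothesis `harch : ∀ v : InfinitePlace L, log⁺ (v N⁻¹) ≤ C₃` of the W5d slope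
assembly at `N := N_c(x, r)`, in the spines' `X_φ`-currency. [cite: MochizukiGenEll2010, Thm 2.1 p.12] -/
theorem posLog_infinitePlace_le_of_XphiC_separated {K : Type*} [Field K] {x r : K} {c : ℚ}
    (hc : c ≠ 0) (hxr : r ^ (2 * k + 1) = x * (1 - x)) {ρ δ : ℝ} (hδ : 0 < δ)
    (h : ∀ P ∈ DeArch.curve ℂ k, (∀ Q ∈ DeArch.curve ℂ k, N k (c : ℂ) Q = 0 → ρ ≤ dist P Q) →
      δ ≤ ‖N k (c : ℂ) P‖)
    {B : Finset ℂ} (hB : DeCrit.critSetC k c ⊆ B) (w : NumberField.InfinitePlace K)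
    (hsep : ∀ a ∈ De.XphiC k (c : ℂ) B, ρ ≤ ‖w.embedding x - a‖) :
    log⁺ (w (N k (c : K) (x, r)))⁻¹ ≤ log⁺ δ⁻¹ :=
  posLog_infinitePlace_le hxr hδ h w (separated_of_XphiC_separated hc hB
    (P := (w.embedding x, w.embedding r)) hsep)

/-- Packaged `InfinitePlace` log form: `∀ c ∈ ℚ^× ∀ ρ > 0 ∃ C₃ ≥ 0` (depending only on `e`, `c`, `ρ`)
such that for every finite `B ⊇ critSetC k c`, every field `K`, every `(x, r) ∈ D_e(K)` and every
infinite place `w` of `K` with `w.embedding x` `ρ`-far from `X_φ`: `log⁺ (w (N_c(x,r)))⁻¹ ≤ C₃`.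
[cite: MochizukiGenEll2010, Thm 2.1 p.12] -/
theorem exists_posLog_infinitePlace_le_of_XphiC_separated (k : ℕ) {c : ℚ} (hc : c ≠ 0) {ρ : ℝ}
    (hρ : 0 < ρ) :
    ∃ C₃ : ℝ, 0 ≤ C₃ ∧ ∀ (B : Finset ℂ), DeCrit.critSetC k c ⊆ B →
      ∀ (K : Type) [Field K] [NumberField K] (x r : K), r ^ (2 * k + 1) = x * (1 - x) →
      ∀ w : NumberField.InfinitePlace K, (∀ a ∈ De.XphiC k (c : ℂ) B, ρ ≤ ‖w.embedding x - a‖) →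
      log⁺ (w (N k (c : K) (x, r)))⁻¹ ≤ C₃ := by
  obtain ⟨δ, hδ, h⟩ := exists_pos_le_norm_N_of_separated k (c := (c : ℂ)) (Rat.cast_ne_zero.mpr hc) hρ
  exact ⟨log⁺ δ⁻¹, posLog_nonneg, fun B hB K _ _ x r hxr w hsep =>
    posLog_infinitePlace_le_of_XphiC_separated hc hxr hδ h hB w hsep⟩

end DeFamily

end Literature.NumberTheory.DiophantineGeometry.GenEll
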